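import Literature.NumberTheory.ComplexMultiplication.EllipticUnits.KatoLayerArtinCompatibility
import Literature.NumberTheory.ComplexMultiplication.EllipticUnits.DivisionPointsIndex
import Mathlib.Algebra.Module.ZLattice.Basic
import HarnessLib

/-!
# Kato's elliptic units `_𝔞z_{p^s𝔣}`: INDEPENDENCE FROM `𝔞` up to 12th roots of unity —
# `u^{N𝔟}·(σ_𝔟 u)⁻¹ = ζ · v^{N𝔞}·(σ_𝔞 v)⁻¹` (`ζ^{12} = 1`) for level-`s` representatives `u`, `v` of
# `_𝔞z`, `_𝔟z`, from de Shalit II.2.4 (ii) (the (GA)-element input of Johnson-Leung–Kings' pin (Z2))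

Topic `NumberTheory/ComplexMultiplication/EllipticUnits`; namespace
`Literature.NumberTheory.ComplexMultiplication.EllipticUnits`. Cell `bsd-print-cf2`
(`run/shared/lean/pub/bsd-print-cf2/`), width seat `bsd-line-cf2-p1-w2` g17, piece (O2) of the F0b
breakdown of `bsd-line-cf2-p1-w5` g9 (planner g20 allocation 14:41:53Z), `--supports` the deciding child
stmt-BirchSwinnertonDyer-24721 of crux 20368. THEOREMS ONLY (no `def`, no named fact, no `sorry`);
CONDITIONAL on the named fact `DeShalit1987.prop24_ii_galoisAction` (de Shalit II.2.4 (ii), PUBLISHED).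

PRINT. Kato, Astérisque 295 §15.5 (p. 253): "`(N(𝔟) − σ_𝔟)(_𝔞z_𝔣) = (N(𝔞) − σ_𝔞)(_𝔟z_𝔣)`" (JLK Prop.
3.3 (3)); its source is de Shalit II.2.4 (ii): "`Θ(v; L, 𝔞)^{σ_𝔠} = Θ(v; 𝔠⁻¹L, 𝔞) = Θ(v; L, 𝔞𝔠)Θ(v; L, 𝔠)^{−N𝔞}`",
whose consequence `Θ(v;L,𝔞)^{N𝔠} / Θ(v;L,𝔞)^{σ_𝔠} = Θ(v;L,𝔞)^{N𝔠}Θ(v;L,𝔠)^{N𝔞} / Θ(v;L,𝔞𝔠)` is symmetric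
in `𝔞 ↔ 𝔠`. Kato's `_𝔞θ_E(α)` is a TWELFTH ROOT of `Θ(1; p^s𝔣, 𝔞)` (the tree's `IsKatoUnitRep`), so for
representatives the identity holds up to `μ₁₂`. WHAT IS PROVED (`K` imaginary quadratic, `ι : K → ℂ`,
`p` prime, `𝔣 ≠ 0`; `σ_𝔠 := layerArtin p 𝔣 s 𝔠`, Kato's lift to `Γ_K` of `(𝔠, K(p^s𝔣)/K)`, acting on `K̄`):
§1 lattice bookkeeping (`ι(𝔪)` has `𝒪_K`-multiplication, `1` is a primitive `𝔪`-division point of it,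
`𝔞⁻¹(𝔟⁻¹Λ) = (𝔞𝔟)⁻¹Λ`, and **`PeriodPair.exists_lattice_eq_of_le`**: every `ℤ`-module `Λ′` with `Λ ≤ Λ′`,
`cΛ′ ≤ Λ` (`c ≠ 0`) is the lattice of a period pair — Mathlib `ZLattice`: discrete + spanning ⇒ a
`ℤ`-basis is an `ℝ`-basis — hence `exists_periodPair_lattice_eq_idealInvLattice` for ANY non-zero `𝔞`,
principal or not); §2 **`exists_katoUnitRep_indep`**: assuming `prop24_ii_galoisAction`, for `1 ≤ s`,
admissible twists `𝔞, 𝔟` and representatives `u, v`: `∃ ζ, ζ^{12} = 1 ∧ u^{N𝔟}·(σ_𝔟 • u)⁻¹ =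
ζ·(v^{N𝔞}·(σ_𝔞 • v)⁻¹)` in `K̄`, and `exists_katoUnitRep_indep_eventually` (`∃ s₁ ∀ s ≥ s₁ …`).
HONEST FRAMING: conditional on ONE published named fact (de Shalit II.2.4 (ii)); nothing here is about an
elliptic curve; BSD is not advanced.

## References
* [Kato2004Asterisque] K. Kato, Astérisque 295 (2004), §15.5 (p. 253), §15.6 (p. 254).
* [JohnsonLeungKings2011] J. Johnson-Leung, G. Kings, J. reine angew. Math. 653 (2011), Prop. 3.3 (3)
  (arXiv:0804.2828 p0009:L122–p0010:L10).
* [deShalit1987] E. de Shalit, *Iwasawa theory of elliptic curves with complex multiplication* (1987),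
  II.2.4 Proposition (ii) (p. 44–45), II.2.3 (10).
* [Silverman1994] J. Silverman, *Advanced Topics in the Arithmetic of Elliptic Curves* (1994), Ch. II §1.1 Cor. 1.5.
-/

noncomputable section

open scoped Classical
open Field NumberField IsDedekindDomain
open Literature.NumberTheory.NumberFields (rayClassField)
open Literature.NumberTheory.GaloisRepresentations
open Literature.NumberTheory.LFunctions.AbelianDensity (artinSymbol)
open Literature.NumberTheory.EllipticCurves

namespace Literature.NumberTheory.ComplexMultiplication.EllipticUnits

/-! ## §1. Lattice bookkeeping -/

section Lattices

variable {K : Type} [Field K]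

/-- The lattice `ι(𝔪) = {ι(a) : a ∈ 𝔪}` has `𝒪_K`-multiplication. [cite: deShalit1987, II.2.3 (10)] -/
theorem isCMLattice_of_mem_iff {ι : K →+* ℂ} {Λ : Submodule ℤ ℂ} {𝔪 : Ideal (𝓞 K)}
    (hΛ : ∀ z : ℂ, z ∈ Λ ↔ ∃ a ∈ 𝔪, z = ι (a : K)) : IsCMLattice ι Λ := by
  intro a x hx
  obtain ⟨m, hm, rfl⟩ := (hΛ x).mp hx
  exact (hΛ _).mpr ⟨a * m, 𝔪.mul_mem_left a hm, by push_cast; rw [map_mul]⟩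

/-- `𝔞⁻¹Λ` again has `𝒪_K`-multiplication. [cite: deShalit1987, II.2.3 (10)] -/
theorem isCMLattice_idealInvLattice {ι : K →+* ℂ} {Λ : Submodule ℤ ℂ} (hΛ : IsCMLattice ι Λ)
    (𝔞 : Ideal (𝓞 K)) : IsCMLattice ι (idealInvLattice ι 𝔞 Λ) := by
  intro a x hx b hb
  rw [mul_left_comm]
  exact hΛ a _ (mem_idealInvLattice_iff.mp hx b hb)

/-- Two lattices both equal to `ι(𝔪)` coincide. [cite: deShalit1987, II.2.3 (10)] -/
theorem lattice_eq_of_mem_iff {ι : K →+* ℂ} {Λ Λ' : Submodule ℤ ℂ} {𝔪 : Ideal (𝓞 K)}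
    (hΛ : ∀ z : ℂ, z ∈ Λ ↔ ∃ a ∈ 𝔪, z = ι (a : K)) (hΛ' : ∀ z : ℂ, z ∈ Λ' ↔ ∃ a ∈ 𝔪, z = ι (a : K)) :
    Λ = Λ' :=
  Submodule.ext fun z ↦ (hΛ z).trans (hΛ' z).symm

/-- **`1` is a primitive `𝔪`-division point of the lattice `ι(𝔪)`** (Kato (15.3.1): the canonical CM pair
over `K(𝔪)` is `(ℂ/𝔪, 1 mod 𝔪)`): the annihilator `{a : ι(a)·1 ∈ ι(𝔪)}` is exactly `𝔪`.
[cite: Kato2004Asterisque, §15.3 (15.3.1) (p. 252)] [cite: deShalit1987, II.2.4 Proposition] -/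
theorem isPrimitiveDivisionPoint_one_of_mem_iff [NumberField K] {ι : K →+* ℂ} {Λ : Submodule ℤ ℂ}
    {𝔪 : Ideal (𝓞 K)} (hΛ : ∀ z : ℂ, z ∈ Λ ↔ ∃ a ∈ 𝔪, z = ι (a : K)) :
    IsPrimitiveDivisionPoint ι 𝔪 Λ 1 := by
  intro a
  rw [mul_one, hΛ]
  constructor
  · rintro ⟨m, hm, h⟩
    have h' : (a : K) = (m : K) := ι.injective h
    rwa [RingOfIntegers.coe_injective h']
  · exact fun ha ↦ ⟨a, ha, rfl⟩

/-- **`1 ∉ 𝔞⁻¹ι(𝔪)` for `𝔞` coprime to `𝔪 ≠ 𝒪_K`** (`1` has level exactly `𝔪` also for `𝔞⁻¹L`; needed to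
know `Θ(1; L, 𝔞) ≠ 0`). [cite: deShalit1987, II.2.4 Proposition (ii)] -/
theorem one_notMem_idealInvLattice_of_isCoprime [NumberField K] {ι : K →+* ℂ} {Λ : Submodule ℤ ℂ}
    {𝔪 𝔞 : Ideal (𝓞 K)} (hΛ : ∀ z : ℂ, z ∈ Λ ↔ ∃ a ∈ 𝔪, z = ι (a : K)) (h𝔪 : 𝔪 ≠ ⊤)
    (h𝔞 : IsCoprime 𝔞 𝔪) : (1 : ℂ) ∉ idealInvLattice ι 𝔞 Λ := by
  intro h1
  have hle : 𝔞 ≤ 𝔪 := fun a ha ↦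
    ((isPrimitiveDivisionPoint_one_of_mem_iff hΛ) a).mp (mem_idealInvLattice_iff.mp h1 a ha)
  apply h𝔪
  rw [← Ideal.isCoprime_iff_sup_eq.mp h𝔞]
  exact le_antisymm le_sup_right (sup_le hle le_rfl)

/-- **`𝔞⁻¹(𝔟⁻¹Λ) = (𝔞𝔟)⁻¹Λ`** for the colon lattices (`𝔞𝔟` is additively generated by the products `ab`).
[cite: deShalit1987, II.2.4 Proposition (ii)] -/
theorem idealInvLattice_idealInvLattice (ι : K →+* ℂ) (𝔞 𝔟 : Ideal (𝓞 K)) (Λ : Submodule ℤ ℂ) :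
    idealInvLattice ι 𝔞 (idealInvLattice ι 𝔟 Λ) = idealInvLattice ι (𝔞 * 𝔟) Λ := by
  ext z
  simp only [mem_idealInvLattice_iff]
  constructor
  · intro h c hc
    refine Submodule.mul_induction_on hc (fun a ha b hb ↦ ?_) (fun x y hx hy ↦ ?_)
    · have h1 := h a ha b hb
      have e : ι ((a * b : 𝓞 K) : K) * z = ι (b : K) * (ι (a : K) * z) := by
        push_cast
        rw [map_mul]
        ring
      rwa [e]
    · have e : ι ((x + y : 𝓞 K) : K) * z = ι (x : K) * z + ι (y : K) * z := by
        push_cast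
        rw [map_add, add_mul]
      rw [e]
      exact Λ.add_mem hx hy
  · intro h a ha b hb
    have h1 := h (a * b) (Ideal.mul_mem_mul ha hb)
    have e : ι ((a * b : 𝓞 K) : K) * z = ι (b : K) * (ι (a : K) * z) := by
      push_cast
      rw [map_mul]
      ring
    rwa [e] at h1

/-- Transport of a system of representatives along an equality of base lattices.
[cite: deShalit1987, II.2.3 (10)] -/
theorem _root_.PeriodPair.IsLatticeReps.of_lattice_eq {L L₂ L' : PeriodPair} {S : Finset ℂ}
    (h : L.IsLatticeReps L' S) (e : L.lattice = L₂.lattice) : L₂.IsLatticeReps L' S :=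
  ⟨fun x ↦ by rw [← e]; exact h.mem_iff x, h.zero_mem,
    fun c hc c' hc' hcc' ↦ h.distinct c hc c' hc' (by rwa [e])⟩

/-- **Every intermediate `ℤ`-module `Λ ≤ Λ′` with `c·Λ′ ⊆ Λ` for some `c ≠ 0` is the lattice of a period
pair** — `Λ′` is discrete (inside the discrete `c⁻¹Λ`) and spans `ℂ` over `ℝ`, so it is a `ℤ`-lattice
of rank `2` (Mathlib `ZLattice.rank`) and any `ℤ`-basis of it is an `ℝ`-basis of `ℂ`
(`Module.Basis.ofZLatticeBasis`). (The superlattices `𝔞⁻¹L` of de Shalit II.2.3 for NON-principal `𝔞`;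
the principal case is the tree's `PeriodPair.mulLeft`.) [cite: deShalit1987, II.2.3 (10)]
[cite: Silverman1994, Ch. II §1.1 Cor. 1.5] -/
theorem _root_.PeriodPair.exists_lattice_eq_of_le (L : PeriodPair) {Λ' : Submodule ℤ ℂ}
    (hle : L.lattice ≤ Λ') {c : ℂ} (hc : c ≠ 0) (hc' : ∀ z ∈ Λ', c * z ∈ L.lattice) :
    ∃ P : PeriodPair, P.lattice = Λ' := by
  haveI : DiscreteTopology ↥(L.lattice : Set ℂ) := inferInstanceAs (DiscreteTopology L.lattice)
  haveI hdisc : DiscreteTopology ↥Λ' := by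
    have h1 : DiscreteTopology ↥((fun z : ℂ ↦ c * z) ⁻¹' (L.lattice : Set ℂ)) :=
      DiscreteTopology.preimage_of_continuous_injective (L.lattice : Set ℂ) (continuous_const_mul c)
        (mul_right_injective₀ hc)
    exact DiscreteTopology.of_subset h1 fun z hz ↦ hc' z hz
  haveI hZ : IsZLattice ℝ Λ' := by
    refine ⟨eq_top_iff.mpr ?_⟩
    rw [← IsZLattice.span_top (K := ℝ) (L := L.lattice)]
    exact Submodule.span_mono (fun z hz ↦ hle hz)
  haveI : Module.Free ℤ Λ' := ZLattice.module_free ℝ Λ'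
  haveI : Module.Finite ℤ Λ' := ZLattice.module_finite ℝ Λ'
  have hrank : Module.finrank ℤ Λ' = 2 := by
    rw [ZLattice.rank ℝ Λ', Complex.finrank_real_complex]
  have hcard : Fintype.card (Module.Free.ChooseBasisIndex ℤ Λ') = 2 := by
    rw [← Module.finrank_eq_card_chooseBasisIndex, hrank]
  let b : Module.Basis (Fin 2) ℤ Λ' :=
    (Module.Free.chooseBasis ℤ Λ').reindex (Fintype.equivFinOfCardEq hcard)
  let B : Module.Basis (Fin 2) ℝ ℂ := b.ofZLatticeBasis ℝ Λ'
  have hB : ∀ i, B i = ((b i : Λ') : ℂ) := fun i ↦ b.ofZLatticeBasis_apply ℝ Λ' i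
  have hfun : (![((b 0 : Λ') : ℂ), ((b 1 : Λ') : ℂ)] : Fin 2 → ℂ) = ⇑B := by
    funext i
    fin_cases i
    · simp [hB]
    · simp [hB]
  refine ⟨⟨((b 0 : Λ') : ℂ), ((b 1 : Λ') : ℂ), by rw [hfun]; exact B.linearIndependent⟩, ?_⟩
  change Submodule.span ℤ {((b 0 : Λ') : ℂ), ((b 1 : Λ') : ℂ)} = Λ'
  have hspan := b.ofZLatticeBasis_span ℝ Λ'
  have hset : ({((b 0 : Λ') : ℂ), ((b 1 : Λ') : ℂ)} : Set ℂ) = Set.range ⇑B := by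
    ext z
    simp only [Set.mem_insert_iff, Set.mem_singleton_iff, Set.mem_range, hB]
    constructor
    · rintro (rfl | rfl)
      · exact ⟨0, rfl⟩
      · exact ⟨1, rfl⟩
    · rintro ⟨i, rfl⟩
      fin_cases i
      · exact Or.inl rfl
      · exact Or.inr rfl
  rw [hset]
  exact hspan

/-- **A period pair with lattice `𝔞⁻¹Λ`** for every lattice `Λ` with `𝒪_K`-multiplication and every
non-zero integral ideal `𝔞` (take `c = ι(a)`, `0 ≠ a ∈ 𝔞`). [cite: deShalit1987, II.2.3 (10)] -/
theorem exists_periodPair_lattice_eq_idealInvLattice [NumberField K] {ι : K →+* ℂ} {L : PeriodPair}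
    (hL : IsCMLattice ι L.lattice) {𝔞 : Ideal (𝓞 K)} (h𝔞 : 𝔞 ≠ ⊥) :
    ∃ P : PeriodPair, P.lattice = idealInvLattice ι 𝔞 L.lattice := by
  obtain ⟨a, ha, ha0⟩ := Submodule.exists_mem_ne_zero_of_ne_bot h𝔞
  have hc : ι (a : K) ≠ 0 := (map_ne_zero ι).mpr (RingOfIntegers.coe_ne_zero_iff.mpr ha0)
  exact L.exists_lattice_eq_of_le (le_idealInvLattice hL 𝔞) hc
    fun z hz ↦ mem_idealInvLattice_iff.mp hz a ha

end Lattices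

/-! ## §2. Independence of Kato's representatives from `𝔞`, up to `μ₁₂` -/

section Indep

variable {K : Type} [Field K] [NumberField K] (p : ℕ) [Fact p.Prime] (𝔣 : Ideal (𝓞 K))

/-- A rational prime is not a unit of `𝓞_K` (its norm is `p^{[K:ℚ]} ≠ ±1`); re-proved privately as in the
sibling files. [cite: NeukirchANT1999, Ch. I §2] -/
private theorem not_isUnit_natCast_of_prime'' {l : ℕ} (hl : l.Prime) : ¬ IsUnit ((l : ℕ) : 𝓞 K) := by
  intro hu
  have h1 : IsUnit (Algebra.norm ℤ ((l : ℕ) : 𝓞 K)) := hu.map _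
  have h2 : Algebra.norm ℤ ((l : ℕ) : 𝓞 K) = (l : ℤ) ^ Module.finrank ℤ (𝓞 K) := by
    rw [show ((l : ℕ) : 𝓞 K) = algebraMap ℤ (𝓞 K) (l : ℤ) by simp, Algebra.norm_algebraMap]
  rw [h2] at h1
  have hpos : 0 < Module.finrank ℤ (𝓞 K) := Module.finrank_pos
  rcases Int.isUnit_iff.mp h1 with h | h
  · have : (l : ℤ) ^ Module.finrank ℤ (𝓞 K) ≥ 2 ^ 1 := by
      calc (l : ℤ) ^ Module.finrank ℤ (𝓞 K) ≥ 2 ^ Module.finrank ℤ (𝓞 K) := by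
            gcongr; exact_mod_cast hl.two_le
        _ ≥ 2 ^ 1 := pow_le_pow_right₀ (by norm_num) hpos
    omega
  · have : (0 : ℤ) ≤ (l : ℤ) ^ Module.finrank ℤ (𝓞 K) := by positivity
    omega

/-- `p^s𝔣 ≠ 𝒪_K` for `s ≥ 1`. [cite: Kato2004Asterisque, §15.1 (p. 250)] -/
theorem katoModulus_ne_top {s : ℕ} (hs : 1 ≤ s) : katoModulus p 𝔣 s ≠ ⊤ := by
  intro h
  have hle : katoModulus p 𝔣 s ≤ Ideal.span {((p : ℕ) : 𝓞 K)} :=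
    (katoModulus_le_span_pow p 𝔣 s).trans (Ideal.pow_le_self (by omega))
  rw [h, top_le_iff, Ideal.span_singleton_eq_top] at hle
  exact not_isUnit_natCast_of_prime'' (Fact.out : p.Prime) hle

omit [Fact p.Prime] in
/-- An admissible twist (prime to `6p𝔣`) is prime to every `p^s𝔣`. [cite: Kato2004Asterisque, §15.6 (p. 254)] -/
theorem IsTwist.isCoprime_katoModulus {𝔞 : Ideal (𝓞 K)} (h : IsTwist p 𝔣 𝔞) (s : ℕ) :
    IsCoprime 𝔞 (katoModulus p 𝔣 s) := by
  have h1 : IsCoprime 𝔞 (katoModulus p 𝔣 1) := h.isCoprime_katoModulus_one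
  rw [katoModulus_one] at h1
  rw [katoModulus]
  exact IsCoprime.mul_right (IsCoprime.pow_right (IsCoprime.of_mul_right_left h1))
    (IsCoprime.of_mul_right_right h1)

omit [NumberField K] [Fact p.Prime] in
/-- The product of two admissible twists is an admissible twist. [cite: Kato2004Asterisque, §15.6 (p. 254)] -/
theorem IsTwist.mul {𝔞 𝔟 : Ideal (𝓞 K)} (ha : IsTwist p 𝔣 𝔞) (hb : IsTwist p 𝔣 𝔟) : IsTwist p 𝔣 (𝔞 * 𝔟) :=
  ⟨IsCoprime.mul_left ha.isCoprime hb.isCoprime,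
    fun h ↦ ha.ne_top (top_le_iff.mp (h ▸ Ideal.mul_le_right))⟩

omit [Fact p.Prime] in
/-- Kato's lifted Artin symbol acts on an element of the layer `K(p^s𝔣)` through the Artin symbol
`(𝔠, K(p^s𝔣)/K)` (unfolding `layerArtin` + `layerLift_smul`). [cite: Kato2004Asterisque, §15.6 (p. 254)] -/
theorem layerArtin_smul_coe (s : ℕ) (𝔠 : Ideal (𝓞 K)) (x : katoLayer p 𝔣 s) :
    layerArtin p 𝔣 s 𝔠 • (x : AlgebraicClosure K) =
      ((artinSymbol (galFrob K (katoLayer p 𝔣 s)) 𝔠 x : katoLayer p 𝔣 s) : AlgebraicClosure K) :=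
  layerLift_smul p 𝔣 s _ x

/-- **INDEPENDENCE OF KATO'S REPRESENTATIVES FROM `𝔞`, UP TO `μ₁₂`** (de Shalit II.2.4 (ii) ⇒ Kato §15.5 /
JLK Prop. 3.3 (3) at the level of the 12th roots). For `K` imaginary quadratic, `1 ≤ s`, admissible twists
`𝔞, 𝔟` of `K(p^s𝔣)` and level-`s` representatives `u` of `_𝔞z_{p^s𝔣}` and `v` of `_𝔟z_{p^s𝔣}`
(`IsKatoUnitRep`): with `σ_𝔠 = layerArtin p 𝔣 s 𝔠` (Kato's lift of `(𝔠, K(p^s𝔣)/K)`) acting on `K̄`,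
**`u^{N𝔟} · (σ_𝔟 • u)⁻¹ = ζ · (v^{N𝔞} · (σ_𝔞 • v)⁻¹)` for some `ζ` with `ζ^{12} = 1`.**
Proof: both sides have the same 12th power, whose image under `ι̂` is
`Θ(1;L,𝔞)^{N𝔟}·Θ(1;L,𝔟)^{N𝔞}/Θ(1;L,𝔞𝔟)` by (ii)(a) `ι̂(σ_𝔠 x) = Θ(1; 𝔠⁻¹L, 𝔞)` and (ii)(b)
`Θ(1;𝔠⁻¹L,𝔞)·Θ(1;L,𝔠)^{N𝔞} = Θ(1;L,𝔞𝔠)`, symmetric in `𝔞 ↔ 𝔟`.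
[cite: deShalit1987, II.2.4 Proposition (ii)] [cite: Kato2004Asterisque, §15.5 (p. 253)]
[cite: JohnsonLeungKings2011, Prop. 3.3 (3) (arXiv p0009:L122–p0010:L10)] -/
theorem exists_katoUnitRep_indep (h24ii : DeShalit1987.prop24_ii_galoisAction)
    (hK : IsImaginaryQuadratic K) (ι : K →+* ℂ) (h𝔣 : 𝔣 ≠ ⊥) {s : ℕ} (hs : 1 ≤ s)
    {𝔞 𝔟 : Ideal (𝓞 K)} (h𝔞 : IsTwist p 𝔣 𝔞) (h𝔟 : IsTwist p 𝔣 𝔟)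
    {u v : (AlgebraicClosure K)ˣ} (hu : IsKatoUnitRep p ι 𝔣 s 𝔞 u) (hv : IsKatoUnitRep p ι 𝔣 s 𝔟 v) :
    ∃ ζ : AlgebraicClosure K, ζ ^ 12 = 1 ∧
      (u : AlgebraicClosure K) ^ Ideal.absNorm 𝔟 * (layerArtin p 𝔣 s 𝔟 • (u : AlgebraicClosure K))⁻¹ =
        ζ * ((v : AlgebraicClosure K) ^ Ideal.absNorm 𝔞 *
          (layerArtin p 𝔣 s 𝔞 • (v : AlgebraicClosure K))⁻¹) := by
  obtain ⟨hu₁, L, La, S, hL, hLa, hS, hθu⟩ := hu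
  obtain ⟨hv₁, L', Lb, S', hL', hLb', hS'', hθv⟩ := hv
  have hLL' : L'.lattice = L.lattice := lattice_eq_of_mem_iff hL' hL
  have hLb : Lb.lattice = idealInvLattice ι 𝔟 L.lattice := by rw [hLb', hLL']
  have hS' : L.IsLatticeReps Lb S' := hS''.of_lattice_eq hLL'
  have hθv' : algClosureEmb ι ((v : AlgebraicClosure K) ^ 12) = L.deShalitTheta Lb S' 1 := by
    rw [hθv, PeriodPair.deShalitTheta_eq_of_lattice_eq hLL' rfl]
  -- the level `𝔪 = p^s𝔣`
  have h𝔪0 : katoModulus p 𝔣 s ≠ ⊥ := katoModulus_ne_bot p 𝔣 h𝔣 s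
  have h𝔪1 : katoModulus p 𝔣 s ≠ ⊤ := katoModulus_ne_top p 𝔣 hs
  have hCM : IsCMLattice ι L.lattice := isCMLattice_of_mem_iff hL
  have hprim : IsPrimitiveDivisionPoint ι (katoModulus p 𝔣 s) L.lattice 1 :=
    isPrimitiveDivisionPoint_one_of_mem_iff hL
  have h𝔞0 : 𝔞 ≠ ⊥ := ne_bot_of_isCoprime_katoModulus p 𝔣 h𝔞.isCoprime_katoModulus_one
  have h𝔟0 : 𝔟 ≠ ⊥ := ne_bot_of_isCoprime_katoModulus p 𝔣 h𝔟.isCoprime_katoModulus_one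
  have h𝔞c : IsCoprime 𝔞 (katoModulus p 𝔣 s) := h𝔞.isCoprime_katoModulus p 𝔣 s
  have h𝔟c : IsCoprime 𝔟 (katoModulus p 𝔣 s) := h𝔟.isCoprime_katoModulus p 𝔣 s
  -- a period pair for `(𝔞𝔟)⁻¹Λ = 𝔞⁻¹(𝔟⁻¹Λ) = 𝔟⁻¹(𝔞⁻¹Λ)` and representatives
  obtain ⟨Lab, hLab⟩ := exists_periodPair_lattice_eq_idealInvLattice hCM (𝔞 := 𝔞 * 𝔟)
    ((h𝔞.mul p 𝔣 h𝔟).isCoprime_katoModulus_one |> ne_bot_of_isCoprime_katoModulus p 𝔣)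
  have hLab_a : Lab.lattice = idealInvLattice ι 𝔞 Lb.lattice := by
    rw [hLab, hLb, idealInvLattice_idealInvLattice]
  have hLab_b : Lab.lattice = idealInvLattice ι 𝔟 La.lattice := by
    rw [hLab, hLa, idealInvLattice_idealInvLattice, mul_comm]
  have hLab' : Lab.lattice = idealInvLattice ι (𝔟 * 𝔞) L.lattice := by rw [hLab, mul_comm]
  have hLbCM : IsCMLattice ι Lb.lattice := hLb ▸ isCMLattice_idealInvLattice hCM 𝔟
  have hLaCM : IsCMLattice ι La.lattice := hLa ▸ isCMLattice_idealInvLattice hCM 𝔞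
  obtain ⟨Sc, hSc⟩ := PeriodPair.IsLatticeReps.exists (L := Lb) (L' := Lab)
    (by rw [hLab_a]; exact le_idealInvLattice hLbCM 𝔞)
  obtain ⟨Sc', hSc'⟩ := PeriodPair.IsLatticeReps.exists (L := La) (L' := Lab)
    (by rw [hLab_b]; exact le_idealInvLattice hLaCM 𝔟)
  obtain ⟨U, hU⟩ := PeriodPair.IsLatticeReps.exists (L := L) (L' := Lab)
    (by rw [hLab]; exact le_idealInvLattice hCM _)
  -- de Shalit II.2.4 (ii) at (𝔪, 𝔞, 𝔠 = 𝔟) and at (𝔪, 𝔟, 𝔠 = 𝔞)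
  obtain ⟨hAa, hAb⟩ := h24ii K hK ι L La Lb Lab Lab S Sc S' U (katoModulus p 𝔣 s) 𝔞 𝔟 1 hCM h𝔪0 h𝔪1
    hprim h𝔞0 h𝔞c h𝔟0 h𝔟c hLa hS hLb hS' hLab_a hSc hLab hU
  obtain ⟨hBa, hBb⟩ := h24ii K hK ι L Lb La Lab Lab S' Sc' S U (katoModulus p 𝔣 s) 𝔟 𝔞 1 hCM h𝔪0 h𝔪1
    hprim h𝔟0 h𝔟c h𝔞0 h𝔞c hLb hS' hLa hS hLab_b hSc' hLab' hU
  have hcardS : S.card = Ideal.absNorm 𝔞 := PeriodPair.IsLatticeReps.card_eq_absNorm hK ι hCM h𝔞0 hLa hS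
  have hcardS' : S'.card = Ideal.absNorm 𝔟 := PeriodPair.IsLatticeReps.card_eq_absNorm hK ι hCM h𝔟0 hLb hS'
  -- the elements `u^12`, `v^12 ∈ K(p^s𝔣)` and the Galois action on them
  set xu : katoLayer p 𝔣 s := ⟨(u : AlgebraicClosure K) ^ 12, pow_mem hu₁.1 12⟩ with hxu_def
  set xv : katoLayer p 𝔣 s := ⟨(v : AlgebraicClosure K) ^ 12, pow_mem hv₁.1 12⟩ with hxv_def
  have hσu : algClosureEmb ι (layerArtin p 𝔣 s 𝔟 • ((u : AlgebraicClosure K) ^ 12)) =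
      Lb.deShalitTheta Lab Sc 1 := by
    have h1 := hAa xu hθu
    rw [← h1, ← layerArtin_smul_coe p 𝔣 s 𝔟 xu]
  have hσv : algClosureEmb ι (layerArtin p 𝔣 s 𝔞 • ((v : AlgebraicClosure K) ^ 12)) =
      La.deShalitTheta Lab Sc' 1 := by
    have h1 := hBa xv hθv'
    rw [← h1, ← layerArtin_smul_coe p 𝔣 s 𝔞 xv]
  have hu0 : (u : AlgebraicClosure K) ≠ 0 := u.ne_zero
  have hv0 : (v : AlgebraicClosure K) ≠ 0 := v.ne_zero
  have hσu0 : layerArtin p 𝔣 s 𝔟 • (u : AlgebraicClosure K) ≠ 0 := by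
    rw [Ne, smul_eq_zero_iff_eq]; exact hu0
  have hσv0 : layerArtin p 𝔣 s 𝔞 • (v : AlgebraicClosure K) ≠ 0 := by
    rw [Ne, smul_eq_zero_iff_eq]; exact hv0
  have hA1 : Lb.deShalitTheta Lab Sc 1 ≠ 0 := by
    rw [← hσu, smul_pow']
    exact (map_ne_zero (algClosureEmb ι)).mpr (pow_ne_zero _ hσu0)
  have hB1 : La.deShalitTheta Lab Sc' 1 ≠ 0 := by
    rw [← hσv, smul_pow']
    exact (map_ne_zero (algClosureEmb ι)).mpr (pow_ne_zero _ hσv0)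
  -- the two quotients and their common twelfth power
  set X : AlgebraicClosure K :=
    (u : AlgebraicClosure K) ^ Ideal.absNorm 𝔟 * (layerArtin p 𝔣 s 𝔟 • (u : AlgebraicClosure K))⁻¹
    with hX
  set Y : AlgebraicClosure K :=
    (v : AlgebraicClosure K) ^ Ideal.absNorm 𝔞 * (layerArtin p 𝔣 s 𝔞 • (v : AlgebraicClosure K))⁻¹
    with hY
  have hY0 : Y ≠ 0 := mul_ne_zero (pow_ne_zero _ hv0) (inv_ne_zero hσv0)
  have hX12 : algClosureEmb ι (X ^ 12) =
      L.deShalitTheta La S 1 ^ Ideal.absNorm 𝔟 * (Lb.deShalitTheta Lab Sc 1)⁻¹ := by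
    have e : X ^ 12 = ((u : AlgebraicClosure K) ^ 12) ^ Ideal.absNorm 𝔟 *
        (layerArtin p 𝔣 s 𝔟 • ((u : AlgebraicClosure K) ^ 12))⁻¹ := by
      rw [hX, mul_pow, ← pow_mul, mul_comm (Ideal.absNorm 𝔟) 12, pow_mul, inv_pow, ← smul_pow']
    rw [e, map_mul, map_pow, map_inv₀, hθu, hσu]
  have hY12 : algClosureEmb ι (Y ^ 12) =
      L.deShalitTheta Lb S' 1 ^ Ideal.absNorm 𝔞 * (La.deShalitTheta Lab Sc' 1)⁻¹ := by
    have e : Y ^ 12 = ((v : AlgebraicClosure K) ^ 12) ^ Ideal.absNorm 𝔞 *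
        (layerArtin p 𝔣 s 𝔞 • ((v : AlgebraicClosure K) ^ 12))⁻¹ := by
      rw [hY, mul_pow, ← pow_mul, mul_comm (Ideal.absNorm 𝔞) 12, pow_mul, inv_pow, ← smul_pow']
    rw [e, map_mul, map_pow, map_inv₀, hθv', hσv]
  rw [hcardS] at hAb
  rw [hcardS'] at hBb
  have key : L.deShalitTheta La S 1 ^ Ideal.absNorm 𝔟 * La.deShalitTheta Lab Sc' 1 =
      L.deShalitTheta Lb S' 1 ^ Ideal.absNorm 𝔞 * Lb.deShalitTheta Lab Sc 1 := by
    rw [mul_comm _ (La.deShalitTheta Lab Sc' 1), hBb, mul_comm _ (Lb.deShalitTheta Lab Sc 1), hAb]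
  have hXY : X ^ 12 = Y ^ 12 := by
    apply (algClosureEmb ι).injective
    rw [hX12, hY12]
    refine mul_right_cancel₀ (mul_ne_zero hA1 hB1) ?_
    have e1 : L.deShalitTheta La S 1 ^ Ideal.absNorm 𝔟 * (Lb.deShalitTheta Lab Sc 1)⁻¹ *
        (Lb.deShalitTheta Lab Sc 1 * La.deShalitTheta Lab Sc' 1) =
        L.deShalitTheta La S 1 ^ Ideal.absNorm 𝔟 * La.deShalitTheta Lab Sc' 1 := by
      rw [mul_assoc, inv_mul_cancel_left₀ hA1]
    have e2 : L.deShalitTheta Lb S' 1 ^ Ideal.absNorm 𝔞 * (La.deShalitTheta Lab Sc' 1)⁻¹ *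
        (Lb.deShalitTheta Lab Sc 1 * La.deShalitTheta Lab Sc' 1) =
        L.deShalitTheta Lb S' 1 ^ Ideal.absNorm 𝔞 * Lb.deShalitTheta Lab Sc 1 := by
      rw [mul_comm (Lb.deShalitTheta Lab Sc 1) _, mul_assoc, inv_mul_cancel_left₀ hB1]
    rw [e1, e2, key]
  refine ⟨X / Y, ?_, ?_⟩
  · rw [div_pow, hXY, div_self (pow_ne_zero _ hY0)]
  · rw [div_mul_cancel₀ X hY0]

/-- **The same with the quantifier shape of the pin** (`∃ s₁, ∀ s ≥ s₁, ∀ 𝔞 𝔟 u v, …`; `s₁ = 1`): for all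
levels `s ≥ 1`, all admissible twists `𝔞, 𝔟` and all representatives `u, v`,
`u^{N𝔟}·(σ_𝔟 • u)⁻¹ = ζ · (v^{N𝔞}·(σ_𝔞 • v)⁻¹)` with `ζ^{12} = 1`.
[cite: deShalit1987, II.2.4 Proposition (ii)] [cite: JohnsonLeungKings2011, Prop. 3.3 (3) (arXiv p0009:L122–p0010:L10)] -/
theorem exists_katoUnitRep_indep_eventually (h24ii : DeShalit1987.prop24_ii_galoisAction)
    (hK : IsImaginaryQuadratic K) (ι : K →+* ℂ) (h𝔣 : 𝔣 ≠ ⊥) :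
    ∃ s₁ : ℕ, ∀ s : ℕ, s₁ ≤ s → ∀ 𝔞 𝔟 : Ideal (𝓞 K), IsTwist p 𝔣 𝔞 → IsTwist p 𝔣 𝔟 →
      ∀ u v : (AlgebraicClosure K)ˣ, IsKatoUnitRep p ι 𝔣 s 𝔞 u → IsKatoUnitRep p ι 𝔣 s 𝔟 v →
        ∃ ζ : AlgebraicClosure K, ζ ^ 12 = 1 ∧
          (u : AlgebraicClosure K) ^ Ideal.absNorm 𝔟 *
              (layerArtin p 𝔣 s 𝔟 • (u : AlgebraicClosure K))⁻¹ =
            ζ * ((v : AlgebraicClosure K) ^ Ideal.absNorm 𝔞 *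
              (layerArtin p 𝔣 s 𝔞 • (v : AlgebraicClosure K))⁻¹) :=
  ⟨1, fun _ hs _ _ h𝔞 h𝔟 _ _ hu hv ↦ exists_katoUnitRep_indep p 𝔣 h24ii hK ι h𝔣 hs h𝔞 h𝔟 hu hv⟩

end Indep

end Literature.NumberTheory.ComplexMultiplication.EllipticUnits
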